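import Literature.AlgebraicGeometry.Motives.MixedHodgeStructureCatTensorStructure
import HarnessLib

/-!
# The internal Hom of `MixedHodgeStructureCat` as a bifunctor: `Hom(−, −) ≅ (−)^∨ ⊗ −`, `Hom(−, ℚ(0)) ≅ (−)^∨`, `Hom(ℚ(0), −) ≅ id`

Layer `Literature/AlgebraicGeometry/Motives` (lane `lit-hodgefound`), completing the categorical internal-Hom cluster g45-#13 (`ihom X`, `− ⊗ X ⊣ Hom(X, −)`),
g45-#14 (`ihomIsoDualTensor : Hom(X, Y) ≅ X^∨ ⊗ Y`, `ihomUnitIso`, `ihomIntoUnitIso`), g45-#15 (`tensorLeft`, `tensorBifunctor`, `finUnitObj`) and g45-#10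
(`dualFunctor : FinSubcategoryᵒᵖ ⥤ FinSubcategory`).  The object-wise isomorphisms of the tree (Deligne's DEFINITION `Hom(H₁, H₂) := H₁^∨ ⊗ H₂`, *Hodge II*
1.1.12 with 1.1.6; El Zein–Lê §3.2.2.7; Deligne–Milne (1.6.4)–(1.7)) are promoted to NATURAL isomorphisms of functors on the finite-dimensional full subcategory:

* §1 the bifunctor **`ihomBifunctor : FinSubcategoryᵒᵖ ⥤ FinSubcategory ⥤ FinSubcategory`** (`X ↦ Hom(X, −)`, `f ↦ Hom(f, 𝟙)`);
* §2 **`ihomIsoTensorLeftDual X : Hom(X, −) ≅ X^∨ ⊗ −`** and, in both variables, **`ihomBifunctorIso : Hom(−, −) ≅ (−)^∨ ⊗ −`**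
  (`ihomBifunctor ≅ dualFunctor ⋙ tensorBifunctor`);
* §3 **`ihomFlipUnitIso : Hom(−, ℚ(0)) ≅ (−)^∨`** (`ihomBifunctor.flip.obj 𝟙 ≅ dualFunctor`: the duality functor IS the internal Hom into the unit) and
  **`ihomUnitNatIso : Hom(ℚ(0), −) ≅ 𝟭`**;
* §4 **`tensorLeftIsoTensorRight X : X ⊗ − ≅ − ⊗ X`** (braiding) and the adjunction **`tensorLeftIhomAdj X : X ⊗ − ⊣ Hom(X, −)`**.

Everything is PROVED; no named fact, no instance, no notation (data: the bifunctor and the three natural isomorphisms, plus `finDualObjIso`-free plumbing).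

Sources, verbatim (through the tree's files).  P. Deligne, *Théorie de Hodge II* (1971) [DeligneHodgeII1971], 1.1.6, 1.1.12 («`Hom(A, B)` … `A^∨ ⊗ B`»; functoriality).
P. Deligne, J. S. Milne, *Tannakian categories*, LNM 900 (1982) [DeligneMilne1982Tannakian], §1 Def. 1.6, (1.6.4) `Hom(1, Hom(X, Y)) = Hom(X, Y)`, (1.6.5)–(1.7)
(`X^∨ = Hom(X, 1)`; in a rigid category `Hom(X, Y) ≅ X^∨ ⊗ Y`).  E. Cattani et al. (eds.), *Hodge Theory* (2014) [CattaniElZeinGriffithsLe2014], Ch. 3 §3.2.2.7 p. 163.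

## Main results

* §1 **`ihomBifunctor`**, `ihomBifunctor_obj`, `ihomBifunctor_map_app_hom`.
* §2 **`ihomIsoTensorLeftDual`**, `ihomIsoTensorLeftDual_hom_app_hom`, **`ihomBifunctorIso`**, `ihomBifunctorIso_hom_app_app_hom`.
* §3 **`ihomFlipUnitIso`**, `ihomFlipUnitIso_hom_app_hom`, **`ihomUnitNatIso`**, `ihomUnitNatIso_hom_app_hom`.
* §4 **`tensorLeftIsoTensorRight`** (`_hom_app_hom`), **`tensorLeftIhomAdj : tensorLeft X ⊣ ihom X`**, `tensorLeft_isLeftAdjoint`.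

## References

* [DeligneHodgeII1971] P. Deligne, Théorie de Hodge II, Publ. Math. IHÉS 40 (1971), 1.1.6, 1.1.12.
* [DeligneMilne1982Tannakian] P. Deligne, J. S. Milne, Tannakian categories, in LNM 900 (1982), §1 Def. 1.6, (1.6.4)–(1.7).
* [CattaniElZeinGriffithsLe2014] E. Cattani et al. (eds.), Hodge Theory, Princeton Math. Notes 49 (2014), Ch. 3 §3.2.2.7 p. 163.

## Provenance

Lane `lit-hodgefound` (summit `HodgeConjecture`), seat `lit-hodgefound-p36` (literature-prover, generation 45, row g45-#16).
-/

noncomputable section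

open CategoryTheory CategoryTheory.Limits Opposite

namespace Literature.AlgebraicGeometry.Motives

universe u

namespace MixedHodgeStructureCat

/-! ## §1 The internal Hom as a bifunctor -/

/-- **`Hom(−, −) : FinSubcategoryᵒᵖ ⥤ FinSubcategory ⥤ FinSubcategory`** — `X ↦ Hom(X, −)` (g45-#13 `ihom`), a morphism `f : X' ⟶ X` acting by the natural
transformation `Hom(f, 𝟙) : Hom(X, −) ⟶ Hom(X', −)`. [cite: DeligneHodgeII1971, 1.1.12] [cite: DeligneMilne1982Tannakian, §1 Def. 1.6] -/
def ihomBifunctor : FinSubcategory.{u}ᵒᵖ ⥤ FinSubcategory.{u} ⥤ FinSubcategory.{u} where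
  obj X := ihom X.unop
  map {X X'} f :=
    { app := fun Y =>
        haveI : Module.Finite ℚ X.unop.obj := X.unop.property
        haveI : Module.Finite ℚ X'.unop.obj := X'.unop.property
        haveI : Module.Finite ℚ Y.obj := Y.property
        ObjectProperty.homMk (ihomMap f.unop.hom (𝟙 Y.obj))
      naturality := fun {Y Y'} g => by
        apply isFinite.hom_ext
        haveI : Module.Finite ℚ X.unop.obj := X.unop.property
        haveI : Module.Finite ℚ X'.unop.obj := X'.unop.property
        haveI : Module.Finite ℚ Y.obj := Y.property
        haveI : Module.Finite ℚ Y'.obj := Y'.property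
        change ihomMap (𝟙 X.unop.obj) g.hom ≫ ihomMap f.unop.hom (𝟙 Y'.obj) = ihomMap f.unop.hom (𝟙 Y.obj) ≫ ihomMap (𝟙 X'.unop.obj) g.hom
        rw [← ihomMap_comp, ← ihomMap_comp, Category.comp_id, Category.comp_id, Category.id_comp, Category.id_comp] }
  map_id X := by
    refine NatTrans.ext (funext fun Y => ?_)
    apply isFinite.hom_ext
    haveI : Module.Finite ℚ X.unop.obj := X.unop.property
    haveI : Module.Finite ℚ Y.obj := Y.property
    exact ihomMap_id X.unop.obj Y.obj
  map_comp {X X' X''} f f' := by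
    refine NatTrans.ext (funext fun Y => ?_)
    apply isFinite.hom_ext
    haveI : Module.Finite ℚ X.unop.obj := X.unop.property
    haveI : Module.Finite ℚ X'.unop.obj := X'.unop.property
    haveI : Module.Finite ℚ X''.unop.obj := X''.unop.property
    haveI : Module.Finite ℚ Y.obj := Y.property
    change ihomMap (f'.unop.hom ≫ f.unop.hom) (𝟙 Y.obj) = ihomMap f.unop.hom (𝟙 Y.obj) ≫ ihomMap f'.unop.hom (𝟙 Y.obj)
    rw [← ihomMap_comp, Category.id_comp]

/-- Unfolding `ihomBifunctor` on objects: `Hom(X, −)`. [cite: DeligneHodgeII1971, 1.1.12] -/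
theorem ihomBifunctor_obj (X : FinSubcategory.{u}ᵒᵖ) : ihomBifunctor.obj X = ihom X.unop := rfl

/-- Unfolding `ihomBifunctor` on morphisms: `Hom(f, 𝟙)`. [cite: DeligneHodgeII1971, 1.1.12] -/
theorem ihomBifunctor_map_app_hom {X X' : FinSubcategory.{u}ᵒᵖ} (f : X ⟶ X') (Y : FinSubcategory.{u}) :
    ((ihomBifunctor.map f).app Y).hom =
      haveI : Module.Finite ℚ X.unop.obj := X.unop.property
      haveI : Module.Finite ℚ X'.unop.obj := X'.unop.property
      haveI : Module.Finite ℚ Y.obj := Y.property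
      ihomMap f.unop.hom (𝟙 Y.obj) := rfl

/-! ## §2 `Hom(−, −) ≅ (−)^∨ ⊗ −` -/

/-- **`Hom(X, −) ≅ X^∨ ⊗ −`** as functors `FinSubcategory ⥤ FinSubcategory` (components g45-#14 `ihomIsoDualTensor`, naturality in the covariant variable).
[cite: DeligneHodgeII1971, 1.1.12] [cite: DeligneMilne1982Tannakian, §1 (1.6.5)–(1.7)] -/
def ihomIsoTensorLeftDual (X : FinSubcategory.{u}) : ihom X ≅ tensorLeft (dualObj X) :=
  NatIso.ofComponents
    (fun Y =>
      haveI : Module.Finite ℚ X.obj := X.property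
      haveI : Module.Finite ℚ Y.obj := Y.property
      isFinite.isoMk (ihomIsoDualTensor X.obj Y.obj))
    (fun {Y Y'} g => by
      apply isFinite.hom_ext
      haveI : Module.Finite ℚ X.obj := X.property
      haveI : Module.Finite ℚ Y.obj := Y.property
      haveI : Module.Finite ℚ Y'.obj := Y'.property
      change ihomMap (𝟙 X.obj) g.hom ≫ (ihomIsoDualTensor X.obj Y'.obj).hom = (ihomIsoDualTensor X.obj Y.obj).hom ≫ tensorHom (𝟙 (of X.obj.str.dual)) g.hom
      rw [ihomMap_comp_ihomIsoDualTensor_hom, transposeHom_id])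

/-- The components of `ihomIsoTensorLeftDual X` are the `ihomIsoDualTensor X Y`. [cite: DeligneHodgeII1971, 1.1.12] -/
theorem ihomIsoTensorLeftDual_hom_app_hom (X Y : FinSubcategory.{u}) :
    ((ihomIsoTensorLeftDual X).hom.app Y).hom =
      haveI : Module.Finite ℚ X.obj := X.property
      haveI : Module.Finite ℚ Y.obj := Y.property
      (ihomIsoDualTensor X.obj Y.obj).hom := rfl

/-- **`Hom(−, −) ≅ (−)^∨ ⊗ −` as bifunctors**: `ihomBifunctor ≅ dualFunctor ⋙ tensorBifunctor` (naturality in BOTH variables; in the contravariant one,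
`Hom(f, 𝟙)` corresponds to `f^∨ ⊗ 𝟙`). [cite: DeligneHodgeII1971, 1.1.12] [cite: DeligneMilne1982Tannakian, §1 (1.6.5)–(1.7)] -/
def ihomBifunctorIso : ihomBifunctor.{u} ≅ dualFunctor.{u} ⋙ tensorBifunctor.{u} :=
  NatIso.ofComponents (fun X => ihomIsoTensorLeftDual X.unop) (fun {X X'} f => by
    refine NatTrans.ext (funext fun Y => ?_)
    apply isFinite.hom_ext
    haveI : Module.Finite ℚ X.unop.obj := X.unop.property
    haveI : Module.Finite ℚ X'.unop.obj := X'.unop.property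
    haveI : Module.Finite ℚ Y.obj := Y.property
    change ihomMap f.unop.hom (𝟙 Y.obj) ≫ (ihomIsoDualTensor X'.unop.obj Y.obj).hom =
      (ihomIsoDualTensor X.unop.obj Y.obj).hom ≫ tensorHom (transposeHom f.unop.hom) (𝟙 Y.obj)
    exact ihomMap_comp_ihomIsoDualTensor_hom f.unop.hom (𝟙 Y.obj))

/-- The components of `ihomBifunctorIso`. [cite: DeligneHodgeII1971, 1.1.12] -/
theorem ihomBifunctorIso_hom_app_app_hom (X : FinSubcategory.{u}ᵒᵖ) (Y : FinSubcategory.{u}) :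
    ((ihomBifunctorIso.hom.app X).app Y).hom =
      haveI : Module.Finite ℚ X.unop.obj := X.unop.property
      haveI : Module.Finite ℚ Y.obj := Y.property
      (ihomIsoDualTensor X.unop.obj Y.obj).hom := rfl

/-! ## §3 `Hom(−, ℚ(0)) ≅ (−)^∨` and `Hom(ℚ(0), −) ≅ 𝟭` -/

/-- **The duality functor is the internal Hom into the unit: `Hom(−, ℚ(0)) ≅ (−)^∨`** (`ihomBifunctor.flip.obj finUnitObj ≅ dualFunctor`; components g45-#14
`ihomIntoUnitIso`, naturality `ihomIntoUnitHom_naturality`). [cite: DeligneMilne1982Tannakian, §1 (1.7)] [cite: CattaniElZeinGriffithsLe2014, Ch. 3 §3.2.2.7 p. 163] -/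
def ihomFlipUnitIso : ihomBifunctor.{u}.flip.obj finUnitObj ≅ dualFunctor.{u} :=
  NatIso.ofComponents
    (fun X =>
      haveI : Module.Finite ℚ X.unop.obj := X.unop.property
      isFinite.isoMk (ihomIntoUnitIso X.unop.obj))
    (fun {X X'} f => by
      apply isFinite.hom_ext
      haveI : Module.Finite ℚ X.unop.obj := X.unop.property
      haveI : Module.Finite ℚ X'.unop.obj := X'.unop.property
      change ihomMap f.unop.hom (𝟙 unitObj.{u}) ≫ ihomIntoUnitHom X'.unop.obj = ihomIntoUnitHom X.unop.obj ≫ transposeHom f.unop.hom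
      exact ihomIntoUnitHom_naturality f.unop.hom)

/-- The components of `ihomFlipUnitIso` are the `ihomIntoUnitIso`. [cite: DeligneMilne1982Tannakian, §1 (1.7)] -/
theorem ihomFlipUnitIso_hom_app_hom (X : FinSubcategory.{u}ᵒᵖ) :
    (ihomFlipUnitIso.hom.app X).hom =
      haveI : Module.Finite ℚ X.unop.obj := X.unop.property
      ihomIntoUnitHom X.unop.obj := rfl

/-- **`Hom(ℚ(0), −) ≅ 𝟭`**: the unit corepresents the identity through the internal Hom (components g45-#14 `ihomUnitIso`, `φ ↦ φ(1)`; Deligne–Milne (1.6.4)).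
[cite: DeligneMilne1982Tannakian, §1 (1.6.4)] -/
def ihomUnitNatIso : ihom finUnitObj.{u} ≅ 𝟭 FinSubcategory.{u} :=
  NatIso.ofComponents
    (fun Y =>
      haveI : Module.Finite ℚ Y.obj := Y.property
      isFinite.isoMk (ihomUnitIso Y.obj))
    (fun {Y Y'} g => by
      apply isFinite.hom_ext
      haveI : Module.Finite ℚ Y.obj := Y.property
      haveI : Module.Finite ℚ Y'.obj := Y'.property
      change ihomMap (𝟙 unitObj.{u}) g.hom ≫ ihomUnitHom Y'.obj = ihomUnitHom Y.obj ≫ g.hom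
      exact ihomUnitHom_naturality g.hom)

/-- The components of `ihomUnitNatIso` are the `ihomUnitIso`. [cite: DeligneMilne1982Tannakian, §1 (1.6.4)] -/
theorem ihomUnitNatIso_hom_app_hom (Y : FinSubcategory.{u}) :
    (ihomUnitNatIso.hom.app Y).hom =
      haveI : Module.Finite ℚ Y.obj := Y.property
      ihomUnitHom Y.obj := rfl

/-! ## §4 `X ⊗ − ≅ − ⊗ X` and the adjunction `X ⊗ − ⊣ Hom(X, −)` -/

/-- **`X ⊗ − ≅ − ⊗ X`** as functors on `FinSubcategory` (components the braiding of g45-#15). [cite: DeligneMilne1982Tannakian, §1 (1.0.2)] -/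
def tensorLeftIsoTensorRight (X : FinSubcategory.{u}) : tensorLeft X ≅ tensorRight X :=
  NatIso.ofComponents
    (fun Y =>
      haveI : Module.Finite ℚ X.obj := X.property
      haveI : Module.Finite ℚ Y.obj := Y.property
      isFinite.isoMk (braiding X.obj Y.obj))
    (fun {Y Y'} g => by
      apply isFinite.hom_ext
      haveI : Module.Finite ℚ X.obj := X.property
      haveI : Module.Finite ℚ Y.obj := Y.property
      haveI : Module.Finite ℚ Y'.obj := Y'.property
      change tensorHom (𝟙 X.obj) g.hom ≫ (braiding X.obj Y'.obj).hom = (braiding X.obj Y.obj).hom ≫ tensorHom g.hom (𝟙 X.obj)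
      exact braiding_naturality (𝟙 X.obj) g.hom)

/-- The components of `tensorLeftIsoTensorRight X` are the braidings `X ⊗ Y ≅ Y ⊗ X`. [cite: DeligneMilne1982Tannakian, §1 (1.0.2)] -/
theorem tensorLeftIsoTensorRight_hom_app_hom (X Y : FinSubcategory.{u}) :
    ((tensorLeftIsoTensorRight X).hom.app Y).hom =
      haveI : Module.Finite ℚ X.obj := X.property
      haveI : Module.Finite ℚ Y.obj := Y.property
      (braiding X.obj Y.obj).hom := rfl

/-- **`X ⊗ − ⊣ Hom(X, −)`** (from g45-#13 `− ⊗ X ⊣ Hom(X, −)` and the symmetry). [cite: DeligneMilne1982Tannakian, §1 Def. 1.6 and (1.0.2)] -/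
def tensorLeftIhomAdj (X : FinSubcategory.{u}) : tensorLeft X ⊣ ihom X := (tensorIhomAdj X).ofNatIsoLeft (tensorLeftIsoTensorRight X).symm

/-- `X ⊗ −` is a left adjoint. [cite: DeligneMilne1982Tannakian, §1 Def. 1.6] -/
theorem tensorLeft_isLeftAdjoint (X : FinSubcategory.{u}) : (tensorLeft X).IsLeftAdjoint := ⟨_, ⟨tensorLeftIhomAdj X⟩⟩

end MixedHodgeStructureCat

end Literature.AlgebraicGeometry.Motives
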